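import Mathlib
import HarnessLib
import Summits.HubbardSuperconductivity.HubbardSuperconductivity.Theorems.KLProgrammeKLRegimeTwoVolumeScaleZeroLegMaj
import Summits.HubbardSuperconductivity.HubbardSuperconductivity.Theorems.KLProgrammeKLRegimeTwoVolumeScaleZeroData
import Summits.HubbardSuperconductivity.HubbardSuperconductivity.Theorems.KLProgrammeKLRegimeTwoVolumeDataKit
import Summits.HubbardSuperconductivity.HubbardSuperconductivity.Theorems.KLProgrammeKLRegimeTwoVolumeRateKit
import Summits.HubbardSuperconductivity.HubbardSuperconductivity.Theorems.KLProgrammeKLRegimeTwoVolumeProfileBridge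
import Summits.HubbardSuperconductivity.HubbardSuperconductivity.Theorems.KLProgrammeKLRegimeTwoVolumeSectionalMomentScaleZero
import Summits.HubbardSuperconductivity.HubbardSuperconductivity.Theorems.KLProgrammeKLRegimeEngineScaleZeroE4Geometry

/-!
# β′ two-volume pass at scale `0` — FILE E, part 1: the (E3f-F)₀ spatial-leg difference from the `gridLabelWt`-weighted row sums ALONE,
# in ε-FREE closed form (cell gate-hubbard-kl, seat hubbard-kl-k3c4-p2 g7, on k3c5-p2 g6's door `…_of_gridData_maj`)

k3c5-p2's `abs_klLocalPart_flowFrame_zero_sub_le_of_gridData_maj` (…TwoVolumeScaleZeroLegMaj) bounds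
`|klLocalPart L₁ M … (K₀) 0 θ − klLocalPart L₂ M … (K₀) 0 θ|`, `L₂ = b·L₁`, by one-volume grid data of `G_L = S_LᵀC⁰_{>e₀}S_L` on the `N = 2(2M)` grid.
Here EVERY model input is discharged from ONE hypothesis family per volume — the `gridLabelWt`-weighted row and column sums
`Σ_Y ‖G_L X Y‖·wt{pos X, pos Y} ≤ a·N/|β|` (the (E4)₀ currency of `EngineV8.rowSum/colSum_scaleZero_gridLabelWt_le_X5`) — plus the admissibility of
the bare frame, `klBetaMin ≤ β ≤ L₁`, three free field radii `ρ, ρf, ρ₂` and FIVE scalar smallness inequalities in ε-free variables: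

* `T := (a N/|β|)/(R+1)` (all-times far tail, `…DataKit` after `1 + tnorm ≤ wt`), `Te := 2^74/(R+1)` (`hsec_scaleZero`), `s = s′ := 2(7+6047)`
  (`hs_scaleZero`), `α = α′ = m₁ = m₁′ := a N/|β|`, `κ = κ′ := √(2(7+6047))`, grid partition functions and the weighted profile
  `Nw m′ = ρ^{-2m′}·(|β|/N)·pw` (`scaleZero_gridData` + `normV_bareGridVertex`), `Nw₁ := Nw 1`, majorants `Bf m = (|β|/N)·bf m`, `B₂ m = (|β|/N)·b₂ m`
  (`normV_geometricProfile_le` + `stepBound_mono`);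
* the powers of `ε = |β|/N` CANCEL TERMWISE: **`abs_klLocalPart_flowFrame_zero_sub_le_rate`** —
  `|Δ| ≤ [12·2^74·b₂4 + 2a(12·b₂1·b₂3 + 8·b₂2²)]/(R+1) + [24·s₀·bf4 + 4a(6·bf1·bf3 + 4·bf2²)]/(R′+1) + 4ρ⁻²·pw/((L₁−1)/2+1)`,
  uniform in `M` (the `hsp` quantifier `∀ M₂ ≥ M0`), with `p = (e²(κ₀+ρ))⁴|U|`, `pw = e·p/(1−e·a·p/κ₀²)`, `xf = pw/(1−qf²)`, `x2 = pw/(1−q₂²)`,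
  `bf m = ρf⁻ᵐ·e·xf/(1−θf)`, `b₂ m = ρ₂⁻ᵐ·e·x2/(1−θ₂)` supplied as generalised variables with defining equations (instantiate with `rfl`).

Part 2 (the `hsp` binder of `EngineV8.stub_twoLeg_scale0_of_spLeg_Q7U9`: `a` from the (E4)₀ export, `R = R′ = (L₁−1)/4`, `U ≤ klEngU₀9` ⇒ the five
smallness facts and `≤ (klEngQ7 P R).CL β 0/4/L₁`) is a separate file.  Proofs only; no definitions.
-/

noncomputable section

namespace Summit.HubbardSuperconductivity.HubbardSuperconductivity.Theorems.TwoVolumeDefect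

set_option linter.dupNamespace false -- summit = problem name (single-conjunct summit), D-0017

open Finset Literature.MathematicalPhysics.QuantumLattice GrassmannAlgebra Literature.Probability.LatticeModels
  Literature.Probability.LatticeModels.BattleFederbush
open Summit.HubbardSuperconductivity.HubbardSuperconductivity.Theorems.KLProgrammeLegKernels
open Summit.HubbardSuperconductivity.HubbardSuperconductivity.Theorems.KLRegimeSplit
open Summit.HubbardSuperconductivity.HubbardSuperconductivity.Theorems.EngineV8
open scoped Nat

/-! ## §1 From `gridLabelWt`-weighted rows to the row data of the door -/

section Rows

variable {L N : ℕ} [NeZero L] [NeZero N]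

/-- `1 + tnorm(x⃗_X − x⃗_Y) ≤ wt{pos X, pos Y}` (`0 ≤ β`). -/
theorem one_add_tnorm_sub_le_gridLabelWt_legPair {β : ℝ} (hβ : 0 ≤ β) (X Y : GridLeg (GridPoint L N)) :
    1 + (Torus.tnorm (X.1.1.2 - Y.1.1.2) : ℝ) ≤ gridLabelWt L N β {gridLegPos X, gridLegPos Y} := by
  rw [gridLabelWt_pair L N hβ]
  linarith [tnorm_sub_le_gridLabelDist hβ X Y]

/-- The four row data of the door from ONE weighted row bound: plain row `≤ αw`, `(1+tnorm)`-row `≤ αw`, `tnorm`-moment `≤ αw`. -/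
theorem rows_of_gridLabelWt_row {β : ℝ} (hβ : 0 ≤ β) (G : Matrix (GridLeg (GridPoint L N)) (GridLeg (GridPoint L N)) ℂ) {αw : ℝ}
    (X : GridLeg (GridPoint L N)) (hrow : ∑ Y, ‖G X Y‖ * gridLabelWt L N β {gridLegPos X, gridLegPos Y} ≤ αw) :
    ∑ Y, ‖G X Y‖ ≤ αw ∧ ∑ Y, ‖G X Y‖ * (1 + (Torus.tnorm (X.1.1.2 - Y.1.1.2) : ℝ)) ≤ αw ∧
      ∑ Y, ‖G X Y‖ * (Torus.tnorm (X.1.1.2 - Y.1.1.2) : ℝ) ≤ αw := by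
  have h2 : ∑ Y, ‖G X Y‖ * (1 + (Torus.tnorm (X.1.1.2 - Y.1.1.2) : ℝ)) ≤ αw :=
    le_trans (sum_le_sum fun Y _ => mul_le_mul_of_nonneg_left (one_add_tnorm_sub_le_gridLabelWt_legPair hβ X Y) (norm_nonneg _)) hrow
  refine ⟨le_trans (sum_le_sum fun Y _ => ?_) h2, h2, le_trans (sum_le_sum fun Y _ => ?_) h2⟩
  · have : (0 : ℝ) ≤ Torus.tnorm (X.1.1.2 - Y.1.1.2) := Nat.cast_nonneg _
    nlinarith [norm_nonneg (G X Y)]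
  · nlinarith [norm_nonneg (G X Y)]

end Rows

/-! ## §2 The (E3f-F)₀ spatial-leg difference from the weighted rows alone, ε-free -/

section Rate

set_option maxHeartbeats 400000 in -- one long instantiation of a 40-hypothesis door + the ε-bookkeeping identity
/-- **FILE E, PART 1 — THE SCALE-`0` SPATIAL-LEG DIFFERENCE FROM THE `gridLabelWt`-WEIGHTED ROWS ALONE, ε-FREE.**
Volumes `L₂ = b·L₁`, cutoff `M` (grid `N = 2(2M)`), admissible bare frame, `klBetaMin ≤ β ≤ L₁`; the weighted row/column sums of
`G_L = S_LᵀC⁰_{>e₀}S_L` at both volumes `≤ a·N/|β|`; radii `ρ, ρf, ρ₂ > 0`; the scalars `κ₀ = √(2(7+6047))`, `p = (e²(κ₀+ρ))⁴|U|`,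
`pw = e·p/(1−e·a·p/κ₀²)`, `xf = pw/(1−qf²)`, `x2 = pw/(1−q₂²)`, `bf m = ρf⁻ᵐ·e·xf/(1−θf)`, `b₂ m = ρ₂⁻ᵐ·e·x2/(1−θ₂)` as generalised
variables with defining equations; five smallness facts.  Then for every `R₀ + R′ ≤ (L₁−1)/2` and every `θ`:
`|klLocalPart L₁ M β U μ K₀ 0 θ − klLocalPart L₂ M β U μ K₀ 0 θ| ≤ [12·2^74·b₂4 + 2a(12·b₂1·b₂3 + 8·b₂2²)]/(R₀+1)`
`+ [24·2(7+6047)·bf4 + 4a(6·bf1·bf3 + 4·bf2²)]/(R′+1) + 4ρ⁻²·pw/((L₁−1)/2+1)` — no `ε = β/N` left. -/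
theorem abs_klLocalPart_flowFrame_zero_sub_le_rate {L₁ L₂ b M : ℕ} [NeZero L₁] [NeZero L₂] [NeZero M]
    (hL : L₂ = b * L₁) {R : RenConsts} {U : ℝ} {Nfr : ℕ} {μ : ℝ} (hK : FrameOK R U Nfr μ 0) {β : ℝ} (hβ : klBetaMin ≤ β)
    (hβL₁ : β ≤ L₁) (R₀ R' : ℕ) (hRR : R₀ + R' ≤ (L₁ - 1) / 2)
    {a : ℝ} (ha : 0 < a)
    (hrow₁ : ∀ X, ∑ Y, ‖((hubbardGridSub L₁ M β (2 * (2 * M))).transpose * hubbardCovAboveCT L₁ M β μ 0 0 klE0 *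
        hubbardGridSub L₁ M β (2 * (2 * M))) X Y‖ * gridLabelWt L₁ (2 * (2 * M)) β {gridLegPos X, gridLegPos Y} ≤
        a * ((2 * (2 * M) : ℕ) : ℝ) / |β|)
    (hcol₁ : ∀ Y, ∑ X, ‖((hubbardGridSub L₁ M β (2 * (2 * M))).transpose * hubbardCovAboveCT L₁ M β μ 0 0 klE0 *
        hubbardGridSub L₁ M β (2 * (2 * M))) X Y‖ * gridLabelWt L₁ (2 * (2 * M)) β {gridLegPos X, gridLegPos Y} ≤
        a * ((2 * (2 * M) : ℕ) : ℝ) / |β|)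
    (hrow₂ : ∀ X, ∑ Y, ‖((hubbardGridSub L₂ M β (2 * (2 * M))).transpose * hubbardCovAboveCT L₂ M β μ 0 0 klE0 *
        hubbardGridSub L₂ M β (2 * (2 * M))) X Y‖ * gridLabelWt L₂ (2 * (2 * M)) β {gridLegPos X, gridLegPos Y} ≤
        a * ((2 * (2 * M) : ℕ) : ℝ) / |β|)
    (hcol₂ : ∀ Y, ∑ X, ‖((hubbardGridSub L₂ M β (2 * (2 * M))).transpose * hubbardCovAboveCT L₂ M β μ 0 0 klE0 *
        hubbardGridSub L₂ M β (2 * (2 * M))) X Y‖ * gridLabelWt L₂ (2 * (2 * M)) β {gridLegPos X, gridLegPos Y} ≤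
        a * ((2 * (2 * M) : ℕ) : ℝ) / |β|)
    {ρ ρf ρ₂ : ℝ} (hρ : 0 < ρ) (hρf : 0 < ρf) (hρ₂ : 0 < ρ₂)
    {κ₀ p pw xf x2 : ℝ} (hκ₀ : κ₀ = Real.sqrt (2 * (7 + 6047)))
    (hp : p = (Real.exp 2 * (κ₀ + ρ)) ^ 4 * |U|)
    (hθ₀ : Real.exp 1 * a * p / κ₀ ^ 2 < 1)
    (hpw : pw = Real.exp 1 * p / (1 - Real.exp 1 * a * p / κ₀ ^ 2))
    (hqf : Real.exp 2 * (κ₀ + κ₀ + ρf) * ρ⁻¹ < 1)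
    (hxf : xf = pw / (1 - (Real.exp 2 * (κ₀ + κ₀ + ρf) * ρ⁻¹) ^ 2))
    (hq2 : Real.exp 2 * (κ₀ + κ₀ + (κ₀ + κ₀ + (κ₀ + κ₀)) + ρ₂) * ρ⁻¹ < 1)
    (hx2 : x2 = pw / (1 - (Real.exp 2 * (κ₀ + κ₀ + (κ₀ + κ₀ + (κ₀ + κ₀)) + ρ₂) * ρ⁻¹) ^ 2))
    (hθf : Real.exp 1 * (a + a + (a + a)) * xf / (κ₀ + κ₀) ^ 2 < 1)
    (hθ2 : Real.exp 1 * (a + a + (a + a)) * x2 / (κ₀ + κ₀ + (κ₀ + κ₀ + (κ₀ + κ₀))) ^ 2 < 1)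
    (bf b2 : ℕ → ℝ)
    (hbf : ∀ m, bf m = ρf⁻¹ ^ m * (Real.exp 1 * xf) / (1 - Real.exp 1 * (a + a + (a + a)) * xf / (κ₀ + κ₀) ^ 2))
    (hb2 : ∀ m, b2 m = ρ₂⁻¹ ^ m * (Real.exp 1 * x2) / (1 - Real.exp 1 * (a + a + (a + a)) * x2 / (κ₀ + κ₀ + (κ₀ + κ₀ + (κ₀ + κ₀))) ^ 2))
    (θ : ℝ) :
    |klLocalPart L₁ M β U μ (klFlowFrameU L₁ M β U μ 0) 0 θ - klLocalPart L₂ M β U μ (klFlowFrameU L₂ M β U μ 0) 0 θ| ≤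
      (12 * 2 ^ 74 * b2 4 + 2 * a * (12 * b2 1 * b2 3 + 8 * b2 2 ^ 2)) / ((R₀ : ℝ) + 1) +
      (24 * (2 * (7 + 6047)) * bf 4 + 4 * a * (6 * bf 1 * bf 3 + 4 * bf 2 ^ 2)) / ((R' : ℝ) + 1) +
      4 * ρ⁻¹ ^ 2 * pw / ((((L₁ - 1) / 2 + 1 : ℕ)) : ℝ) := by
  classical
  subst hκ₀
  haveI : NeZero (2 * (2 * M)) := ⟨by have := NeZero.ne M; omega⟩
  -- scalars
  have hNpos : (0 : ℝ) < ((2 * (2 * M) : ℕ) : ℝ) := by have := NeZero.pos M; positivity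
  have hβpos : 0 < β := lt_of_lt_of_le (by norm_num [klBetaMin]) hβ
  have hβ0 : 0 ≤ β := hβpos.le
  have haβ : 0 < |β| := abs_pos.2 hβpos.ne'
  have hL₁₂ : L₁ ≤ L₂ := by
    have hb0 : b ≠ 0 := by rintro rfl; exact NeZero.ne L₂ (by rw [hL, zero_mul])
    rw [hL]; exact Nat.le_mul_of_pos_left _ (Nat.pos_of_ne_zero hb0)
  have hβL₂ : β ≤ L₂ := hβL₁.trans (by exact_mod_cast hL₁₂)
  have hdvd : L₁ ∣ L₂ := ⟨b, by rw [hL, mul_comm]⟩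
  have hκ₀ : 0 < Real.sqrt (2 * (7 + 6047)) := Real.sqrt_pos.2 (by norm_num)
  set κ₀ := Real.sqrt (2 * (7 + 6047)) with hκ₀def
  set ε : ℝ := |β| / ((2 * (2 * M) : ℕ) : ℝ) with hεdef
  have hε : 0 < ε := div_pos haβ hNpos
  set αw : ℝ := a * ((2 * (2 * M) : ℕ) : ℝ) / |β| with hαwdef
  have hαw : 0 < αw := div_pos (mul_pos ha hNpos) haβ
  have hαε : αw * ε = a := by rw [hαwdef, hεdef]; field_simp
  have he1 : 0 < Real.exp 1 := Real.exp_pos 1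
  have hp0 : 0 ≤ p := by rw [hp]; positivity
  have hden₀ : 0 < 1 - Real.exp 1 * a * p / κ₀ ^ 2 := by linarith
  have hpw0 : 0 ≤ pw := by rw [hpw]; positivity
  have hdenf : 0 < 1 - (Real.exp 2 * (κ₀ + κ₀ + ρf) * ρ⁻¹) ^ 2 := by
    have h1 : 0 ≤ Real.exp 2 * (κ₀ + κ₀ + ρf) * ρ⁻¹ := by positivity
    nlinarith
  have hden2 : 0 < 1 - (Real.exp 2 * (κ₀ + κ₀ + (κ₀ + κ₀ + (κ₀ + κ₀)) + ρ₂) * ρ⁻¹) ^ 2 := by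
    have h1 : 0 ≤ Real.exp 2 * (κ₀ + κ₀ + (κ₀ + κ₀ + (κ₀ + κ₀)) + ρ₂) * ρ⁻¹ := by positivity
    nlinarith
  have hxf0 : 0 ≤ xf := by rw [hxf]; positivity
  have hx20 : 0 ≤ x2 := by rw [hx2]; positivity
  -- the two grid covariances
  set G₁ := (hubbardGridSub L₁ M β (2 * (2 * M))).transpose * hubbardCovAboveCT L₁ M β μ 0 0 klE0 * hubbardGridSub L₁ M β (2 * (2 * M))
    with hG₁
  set G₂ := (hubbardGridSub L₂ M β (2 * (2 * M))).transpose * hubbardCovAboveCT L₂ M β μ 0 0 klE0 * hubbardGridSub L₂ M β (2 * (2 * M))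
    with hG₂
  -- row data
  have rows₁ := fun X => rows_of_gridLabelWt_row hβ0 G₁ X (hrow₁ X)
  have rows₂ := fun X => rows_of_gridLabelWt_row hβ0 G₂ X (hrow₂ X)
  -- `scaleZero_gridData` at both volumes
  have hθlit : Real.exp 1 * αw * ((Real.exp 2 * (κ₀ + ρ)) ^ 4 * (|U| * |β| / ((2 * (2 * M) : ℕ) : ℝ))) / κ₀ ^ 2 < 1 := by
    have h : Real.exp 1 * αw * ((Real.exp 2 * (κ₀ + ρ)) ^ 4 * (|U| * |β| / ((2 * (2 * M) : ℕ) : ℝ))) / κ₀ ^ 2 =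
        Real.exp 1 * a * p / κ₀ ^ 2 := by
      rw [hp, hαwdef]; field_simp
    rw [h]; exact hθ₀
  obtain ⟨hGB₁, hZ₁, hprof₁⟩ := scaleZero_gridData (L := L₁) (M := M) hK hβ hβL₁ hαw hrow₁ hcol₁ hρ
    (by rw [normV_bareGridVertex]; exact hθlit)
  obtain ⟨hGB₂, hZ₂, hprof₂⟩ := scaleZero_gridData (L := L₂) (M := M) hK hβ hβL₂ hαw hrow₂ hcol₂ hρ
    (by rw [normV_bareGridVertex]; exact hθlit)
  -- the weighted profile `Nw m′ = ρ^{-2m′}·(ε·pw)`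
  set Pw : ℝ := ε * pw with hPwdef
  have hPw0 : 0 ≤ Pw := mul_nonneg hε.le hpw0
  have hPwL : ∀ (L : ℕ) [NeZero L], Real.exp 1 * normV (GridLeg (GridPoint L (2 * (2 * M)))) κ₀ ρ
      (fun m' : ℕ => if m' = 1 then |β| / (2 * (2 * M) : ℕ) * ∑ z : TorusSite 2 L, ‖framePosKernel L (0 : TrigPolyC4v) z‖ * (1 + torusSiteDist z 0)
        else if m' = 2 then |U| * |β| / (2 * (2 * M) : ℕ) else 0) /
      (1 - Real.exp 1 * αw * normV (GridLeg (GridPoint L (2 * (2 * M)))) κ₀ ρ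
        (fun m' : ℕ => if m' = 1 then |β| / (2 * (2 * M) : ℕ) * ∑ z : TorusSite 2 L, ‖framePosKernel L (0 : TrigPolyC4v) z‖ * (1 + torusSiteDist z 0)
          else if m' = 2 then |U| * |β| / (2 * (2 * M) : ℕ) else 0) / κ₀ ^ 2) = Pw := by
    intro L _
    rw [normV_bareGridVertex]
    have h1 : (Real.exp 2 * (κ₀ + ρ)) ^ 4 * (|U| * |β| / ((2 * (2 * M) : ℕ) : ℝ)) = ε * p := by
      rw [hp, hεdef]; ring
    rw [h1, hPwdef, hpw]
    have h2 : Real.exp 1 * αw * (ε * p) / κ₀ ^ 2 = Real.exp 1 * a * p / κ₀ ^ 2 := by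
      rw [← hαε]; ring
    rw [h2]
    field_simp
  set Nw : ℕ → ℝ := fun m' => ρ⁻¹ ^ (2 * m') * Pw with hNwdef
  have hNw0 : ∀ m', 0 ≤ Nw m' := fun m' => by rw [hNwdef]; positivity
  have hprofEq : ∀ (L : ℕ) [NeZero L] (m' : ℕ), ρ⁻¹ ^ (2 * m') * (Real.exp 1 * normV (GridLeg (GridPoint L (2 * (2 * M)))) κ₀ ρ
      (fun m' : ℕ => if m' = 1 then |β| / (2 * (2 * M) : ℕ) * ∑ z : TorusSite 2 L, ‖framePosKernel L (0 : TrigPolyC4v) z‖ * (1 + torusSiteDist z 0)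
        else if m' = 2 then |U| * |β| / (2 * (2 * M) : ℕ) else 0)) /
      (1 - Real.exp 1 * αw * normV (GridLeg (GridPoint L (2 * (2 * M)))) κ₀ ρ
        (fun m' : ℕ => if m' = 1 then |β| / (2 * (2 * M) : ℕ) * ∑ z : TorusSite 2 L, ‖framePosKernel L (0 : TrigPolyC4v) z‖ * (1 + torusSiteDist z 0)
          else if m' = 2 then |U| * |β| / (2 * (2 * M) : ℕ) else 0) / κ₀ ^ 2) = Nw m' := by
    intro L _ m'
    rw [mul_div_assoc, hPwL L]
  have hNw := fun (m' : ℕ) (j : Fin (2 * m')) (x : GridLeg (GridPoint L₁ (2 * (2 * M)))) =>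
    (hprof₁ m' j x).trans (le_of_eq (hprofEq L₁ m'))
  have hNw1 := (hprof₂ 1 0 ((((0 : Fin (2 * (2 * M))), fun _ => (((L₁ - 1) / 2 : ℕ) : ZMod L₂)), 0), 0)).trans
    (le_of_eq (hprofEq L₂ 1))
  -- majorants of the two `normV`'s of the profile
  set Xf : ℝ := ε * xf with hXfdef
  set X2 : ℝ := ε * x2 with hX2def
  have hκκ : 0 ≤ κ₀ + κ₀ + ρf := by positivity
  have hκ6 : 0 ≤ κ₀ + κ₀ + (κ₀ + κ₀ + (κ₀ + κ₀)) + ρ₂ := by positivity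
  have hnVf : normV (GridLeg (GridPoint L₂ (2 * (2 * M)))) (κ₀ + κ₀) ρf Nw ≤ Xf := by
    have h := normV_geometricProfile_le (Γ := GridLeg (GridPoint L₂ (2 * (2 * M)))) (κ := κ₀ + κ₀) (ρ := ρf) (ρ₀ := ρ)
      (P := Pw) hκκ hρ hPw0 hqf
    refine (le_of_eq (by rw [hNwdef])).trans (h.trans (le_of_eq ?_))
    rw [hXfdef, hxf, hPwdef]
    ring
  have hnV2 : normV (GridLeg (GridPoint L₂ (2 * (2 * M)))) (κ₀ + κ₀ + (κ₀ + κ₀ + (κ₀ + κ₀))) ρ₂ Nw ≤ X2 := by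
    have h := normV_geometricProfile_le (Γ := GridLeg (GridPoint L₂ (2 * (2 * M)))) (κ := κ₀ + κ₀ + (κ₀ + κ₀ + (κ₀ + κ₀)))
      (ρ := ρ₂) (ρ₀ := ρ) (P := Pw) hκ6 hρ hPw0 hq2
    refine (le_of_eq (by rw [hNwdef])).trans (h.trans (le_of_eq ?_))
    rw [hX2def, hx2, hPwdef]
    ring
  have hnV0f : 0 ≤ normV (GridLeg (GridPoint L₂ (2 * (2 * M)))) (κ₀ + κ₀) ρf Nw := normV_nonneg (by positivity) hρf.le hNw0
  have hnV02 : 0 ≤ normV (GridLeg (GridPoint L₂ (2 * (2 * M)))) (κ₀ + κ₀ + (κ₀ + κ₀ + (κ₀ + κ₀))) ρ₂ Nw :=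
    normV_nonneg (by positivity) hρ₂.le hNw0
  -- the two smallness conditions in the door's currency
  have hα4 : 0 ≤ αw + αw + (αw + αw) := by positivity
  have hθfX : Real.exp 1 * (αw + αw + (αw + αw)) * Xf / (κ₀ + κ₀) ^ 2 = Real.exp 1 * (a + a + (a + a)) * xf / (κ₀ + κ₀) ^ 2 := by
    rw [hXfdef, ← hαε]; ring
  have hθ2X : Real.exp 1 * (αw + αw + (αw + αw)) * X2 / (κ₀ + κ₀ + (κ₀ + κ₀ + (κ₀ + κ₀))) ^ 2 =
      Real.exp 1 * (a + a + (a + a)) * x2 / (κ₀ + κ₀ + (κ₀ + κ₀ + (κ₀ + κ₀))) ^ 2 := by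
    rw [hX2def, ← hαε]; ring
  have hθfb : Real.exp 1 * (αw + αw + (αw + αw)) * Xf / (κ₀ + κ₀) ^ 2 < 1 := by rw [hθfX]; exact hθf
  have hθ2b : Real.exp 1 * (αw + αw + (αw + αw)) * X2 / (κ₀ + κ₀ + (κ₀ + κ₀ + (κ₀ + κ₀))) ^ 2 < 1 := by rw [hθ2X]; exact hθ2
  have hθw : Real.exp 1 * (αw + αw + (αw + αw)) * normV (GridLeg (GridPoint L₂ (2 * (2 * M)))) (κ₀ + κ₀) ρf Nw / (κ₀ + κ₀) ^ 2 < 1 :=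
    lt_of_le_of_lt (theta_mono hnVf hα4) hθfb
  have hθ₂ : Real.exp 1 * (αw + αw + (αw + αw)) * normV (GridLeg (GridPoint L₂ (2 * (2 * M)))) (κ₀ + κ₀ + (κ₀ + κ₀ + (κ₀ + κ₀))) ρ₂ Nw /
      (κ₀ + κ₀ + (κ₀ + κ₀ + (κ₀ + κ₀))) ^ 2 < 1 :=
    lt_of_le_of_lt (theta_mono hnV2 hα4) hθ2b
  -- the majorant functions
  set Bf : ℕ → ℝ := fun m => ρf⁻¹ ^ m * (Real.exp 1 * Xf) / (1 - Real.exp 1 * (αw + αw + (αw + αw)) * Xf / (κ₀ + κ₀) ^ 2) with hBfdef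
  set B₂ : ℕ → ℝ := fun m => ρ₂⁻¹ ^ m * (Real.exp 1 * X2) /
    (1 - Real.exp 1 * (αw + αw + (αw + αw)) * X2 / (κ₀ + κ₀ + (κ₀ + κ₀ + (κ₀ + κ₀))) ^ 2) with hB₂def
  have hBf : ∀ m, ρf⁻¹ ^ m * (Real.exp 1 * normV (GridLeg (GridPoint L₂ (2 * (2 * M)))) (κ₀ + κ₀) ρf Nw) /
      (1 - Real.exp 1 * (αw + αw + (αw + αw)) * normV (GridLeg (GridPoint L₂ (2 * (2 * M)))) (κ₀ + κ₀) ρf Nw / (κ₀ + κ₀) ^ 2) ≤ Bf m :=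
    fun m => stepBound_mono hnV0f hnVf hα4 (by positivity) hρf hθfb m
  have hB2 : ∀ m, ρ₂⁻¹ ^ m * (Real.exp 1 * normV (GridLeg (GridPoint L₂ (2 * (2 * M)))) (κ₀ + κ₀ + (κ₀ + κ₀ + (κ₀ + κ₀))) ρ₂ Nw) /
      (1 - Real.exp 1 * (αw + αw + (αw + αw)) * normV (GridLeg (GridPoint L₂ (2 * (2 * M)))) (κ₀ + κ₀ + (κ₀ + κ₀ + (κ₀ + κ₀))) ρ₂ Nw /
        (κ₀ + κ₀ + (κ₀ + κ₀ + (κ₀ + κ₀))) ^ 2) ≤ B₂ m :=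
    fun m => stepBound_mono hnV02 hnV2 hα4 (by positivity) hρ₂ hθ2b m
  have hBfε : ∀ m, Bf m = ε * bf m := by
    intro m
    rw [hBfdef, hbf]
    dsimp only
    rw [hθfX, hXfdef]
    ring
  have hB2ε : ∀ m, B₂ m = ε * b2 m := by
    intro m
    rw [hB₂def, hb2]
    dsimp only
    rw [hθ2X, hX2def]
    ring
  -- the far tails and the sup entries
  have hT : ∀ X', ∑ Y' ∈ univ.filter (fun Y' : GridLeg (GridPoint L₂ (2 * (2 * M))) => R₀ < Torus.tnorm (X'.1.1.2 - Y'.1.1.2)),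
      ‖G₂ X' Y'‖ ≤ αw / ((R₀ : ℝ) + 1) := fun X' => sum_far_norm_le_of_weightedRow G₂ R₀ X' (rows₂ X').2.1
  have hT0 : 0 < αw / ((R₀ : ℝ) + 1) := by positivity
  have hsec' : ∀ (X' : GridLeg (GridPoint L₂ (2 * (2 * M)))) (t : Fin (2 * (2 * M))) (σ c : Fin 2),
      ∑ y ∈ univ.filter (fun y : TorusSite 2 L₂ => R₀ < Torus.tnorm (X'.1.1.2 - y)), ‖G₂ X' (((t, y), σ), c)‖ ≤
        (2 : ℝ) ^ 74 / ((R₀ : ℝ) + 1) := fun X' t σ c => hsec_scaleZero (L := L₂) (M := M) hβpos μ R₀ X' t σ c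
  have hs₁ : ∀ X Y, ‖G₁ X Y‖ ≤ 2 * (7 + 6047) := fun X Y => hs_scaleZero (L := L₁) (M := M) hK hβ hβL₁ X Y
  have hs₂ : ∀ X Y, ‖G₂ X Y‖ ≤ 2 * (7 + 6047) := fun X Y => hs_scaleZero (L := L₂) (M := M) hK hβ hβL₂ X Y
  have hm1' : ∀ X', ∑ Y', ‖G₂ X' Y'‖ *
      (Torus.tnorm ((fun i => (((X'.1.1.2 i).val : ℕ) : ZMod L₁)) - fun i => (((Y'.1.1.2 i).val : ℕ) : ZMod L₁)) : ℝ) ≤ αw :=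
    fun X' => (sum_norm_mul_tnorm_reduce_le hdvd G₂ X').trans (rows₂ X').2.2
  -- the door
  have hdoor := abs_klLocalPart_flowFrame_zero_sub_le_of_gridData_maj (M := M) hL hβpos U μ R₀ R' hRR hT0 hT hsec'
    (by norm_num) (by norm_num) hs₁ hs₂ (add_pos hαw hαw) (fun X => (rows₁ X).1) (fun X' => (rows₂ X').1) hαw.le hαw.le
    (fun X => (rows₁ X).2.2) hm1' hκ₀ hκ₀.le hGB₁ hGB₂ hZ₁ hZ₂ Nw hNw0 hNw hρf hθw hρ₂ hθ₂ Bf B₂ hBf hB2 hNw1 θ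
  refine hdoor.trans (le_of_eq ?_)
  -- ε-bookkeeping
  have hNw1v : Nw 1 = ρ⁻¹ ^ 2 * (ε * pw) := by rw [hNwdef]
  have hε2 : 2 * ((2 * (2 * M) : ℕ) : ℝ) / |β| = 2 * ε⁻¹ := by rw [hεdef, inv_div]; ring
  have hεa : αw = a * ε⁻¹ := by rw [hαwdef, hεdef, inv_div]; ring
  have hhalf : ‖(2 : ℂ)⁻¹‖ = 2⁻¹ := by simp
  rw [hNw1v, hε2, hεa, hhalf]
  simp only [hBfε, hB2ε, Finset.sum_range_succ, Finset.sum_range_zero]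
  norm_num
  field_simp
  ring

end Rate

end Summit.HubbardSuperconductivity.HubbardSuperconductivity.Theorems.TwoVolumeDefect

end
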